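import Summits.AtomisticToContinuum.BoseEinsteinCondensation.Theses.BECSwapNoCatastrophe
import Summits.AtomisticToContinuum.BoseEinsteinCondensation.Theorems.BECSwapNoCatastropheMidpointLemmaTwoCopy
import HarnessLib

/-!
# Crux `TorusHalfSwapOverlap` (stmt-AtomisticToContinuum-14393), line `birth`, stub `stub_swapInvariance`

Route `BECSwapNoCatastrophe` (sub-problem `BoseEinsteinCondensation`). Fixed-`n` stub: the one-pair swap `F (X, Y) = (y₀ :: X̂, x₀ :: Ŷ)` preserves the absolute admissible class and the half-swapped two-copy form `E2(½)`.

This file proves the REGISTERED stub signature verbatim (tree vocabulary, the two-copy objects inlined as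
`let`s exactly as in the route decls), under the registered name, in the line's namespace; it cannot import
the `Cruxes/` skeleton, which reads it back definitionally.

Proof outline. `F` is a continuous linear involution of `(ℝ³)^{n+1} × (ℝ³)^{n+1}` permuting the
coordinate directions: `C¹` is composition with a continuous linear map, periodicity and the
kinetic density follow from the action of `F` on the coordinate directions
(`F (e_{0} ⊗ u, 0) = (0, e_0 ⊗ u)`, `F (e_{j+1} ⊗ u, 0) = (e_{j+1} ⊗ u, 0)`, …) and the chain rule,
and the normalisation and the energy follow from the change of variables `Z ↦ F Z`, a
measure-preserving measurable involution (in the glue coordinates of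
`exists_measurableEquiv_twoCopy` it is `Prod.map id Prod.swap`) mapping the cell onto itself.
-/

noncomputable section

-- The Lebesgue `MeasureSpace` instance of the glue coordinates
-- `((ℝ³)ⁿ × (ℝ³)ⁿ) × (ℝ³ × ℝ³)` exceeds the default `synthInstance.maxSize`; raise the bound
-- (as in `Theorems/BECSwapNoCatastropheMidpointLemmaTwoCopy.lean`).
set_option synthInstance.maxSize 512

open MeasureTheory Filter
open scoped ENNReal NNReal BigOperators ComplexConjugate

namespace Summit.AtomisticToContinuum.BoseEinsteinCondensation.Cruxes.TorusHalfSwapOverlap.Birth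

open Literature.MathematicalPhysics.QuantumManyBody.BoseGas
open Summit.AtomisticToContinuum.BoseEinsteinCondensation.Theses.BECSwapNoCatastrophe (TorusSwapPathRigidity)

/-! ### Helper lemmas (keep them `private` or inside `namespace SwapInvariance … end SwapInvariance`) -/

namespace SwapInvariance

open Summit.AtomisticToContinuum.BoseEinsteinCondensation.Theorems (exists_measurableEquiv_twoCopy)

variable {n : ℕ}

/-! #### Vector bookkeeping on `(ℝ³)^{n+1}` -/

/-- `tail (x :: u) = u`. [folklore] -/
theorem tail_vecCons (x : Space) (u : Config n) : Fin.tail (Matrix.vecCons x u : Config (n + 1)) = u :=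
  funext fun j => Matrix.cons_val_succ x u j

/-- `(tail X) j = X (j+1)`. [folklore] -/
theorem tail_apply (X : Config (n + 1)) (j : Fin n) : Fin.tail X j = X j.succ :=
  rfl

/-- `tail 0 = 0`. [folklore] -/
theorem tail_zero : Fin.tail (0 : Config (n + 1)) = (0 : Config n) :=
  rfl

/-- `tail (e₀ ⊗ u) = 0`. [folklore] -/
theorem tail_single_zero (u : Space) :
    Fin.tail (Pi.single (0 : Fin (n + 1)) u : Config (n + 1)) = (0 : Config n) := by
  funext j
  rw [tail_apply, Pi.single_eq_of_ne (Fin.succ_ne_zero j), Pi.zero_apply]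

/-- `tail (e_{j+1} ⊗ u) = e_j ⊗ u`. [folklore] -/
theorem tail_single_succ (j : Fin n) (u : Space) :
    Fin.tail (Pi.single j.succ u : Config (n + 1)) = Pi.single j u := by
  funext i
  rw [tail_apply]
  by_cases h : i = j
  · subst h
    rw [Pi.single_eq_same, Pi.single_eq_same]
  · rw [Pi.single_eq_of_ne h, Pi.single_eq_of_ne (fun h' => h (Fin.succ_injective _ h'))]

/-- `u :: 0 = e₀ ⊗ u`. [folklore] -/
theorem vecCons_zero_right (u : Space) :
    (Matrix.vecCons u (0 : Config n) : Config (n + 1)) = Pi.single 0 u := by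
  funext i
  refine Fin.cases ?_ (fun j => ?_) i
  · rw [Matrix.cons_val_zero, Pi.single_eq_same]
  · rw [Matrix.cons_val_succ, Pi.single_eq_of_ne (Fin.succ_ne_zero j), Pi.zero_apply]

/-- `0 :: (e_j ⊗ u) = e_{j+1} ⊗ u`. [folklore] -/
theorem vecCons_zero_single (j : Fin n) (u : Space) :
    (Matrix.vecCons 0 (Pi.single j u) : Config (n + 1)) = Pi.single j.succ u := by
  funext i
  refine Fin.cases ?_ (fun i => ?_) i
  · rw [Matrix.cons_val_zero, Pi.single_eq_of_ne (Fin.succ_ne_zero j).symm]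
  · rw [Matrix.cons_val_succ]
    by_cases h : i = j
    · subst h
      rw [Pi.single_eq_same, Pi.single_eq_same]
    · rw [Pi.single_eq_of_ne h, Pi.single_eq_of_ne (fun h' => h (Fin.succ_injective _ h'))]

/-! #### The swap as a continuous linear map, and its action on the coordinate directions -/

/-- The one-pair swap `(X, Y) ↦ (y₀ :: X̂, x₀ :: Ŷ)` is (the underlying map of) a continuous
linear map of `(ℝ³)^{n+1} × (ℝ³)^{n+1}`. [folklore] -/
theorem exists_clm (n : ℕ) :
    ∃ Fl : (Config (n + 1) × Config (n + 1)) →L[ℝ] (Config (n + 1) × Config (n + 1)),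
      ∀ Z, Fl Z = (Matrix.vecCons (Z.2 0) (Fin.tail Z.1), Matrix.vecCons (Z.1 0) (Fin.tail Z.2)) := by
  refine ⟨LinearMap.toContinuousLinearMap
    { toFun := fun Z => (Matrix.vecCons (Z.2 0) (Fin.tail Z.1), Matrix.vecCons (Z.1 0) (Fin.tail Z.2))
      map_add' := fun Z W => ?_
      map_smul' := fun c Z => ?_ }, fun Z => rfl⟩
  · simp only [Prod.fst_add, Prod.snd_add, Pi.add_apply, Prod.mk_add_mk, Matrix.cons_add_cons]
    rfl
  · simp only [Prod.smul_fst, Prod.smul_snd, Pi.smul_apply, RingHom.id_apply, Prod.smul_mk,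
      Matrix.smul_cons]
    rfl

section Directions

variable (Fl : (Config (n + 1) × Config (n + 1)) →L[ℝ] (Config (n + 1) × Config (n + 1)))
  (hFl : ∀ Z, Fl Z = (Matrix.vecCons (Z.2 0) (Fin.tail Z.1), Matrix.vecCons (Z.1 0) (Fin.tail Z.2)))
include hFl

/-- `F (e₀ ⊗ u, 0) = (0, e₀ ⊗ u)` and `F (0, e₀ ⊗ u) = (e₀ ⊗ u, 0)`: displacements of the two
tagged particles trade places. [folklore] -/
theorem fl_single_zero (u : Space) :
    Fl (Pi.single 0 u, 0) = (0, Pi.single 0 u) ∧ Fl (0, Pi.single 0 u) = (Pi.single 0 u, 0) := by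
  rw [hFl, hFl]
  dsimp only
  rw [Pi.zero_apply, Pi.single_eq_same, tail_single_zero, tail_zero, Matrix.cons_zero_zero,
    vecCons_zero_right]
  exact ⟨rfl, rfl⟩

/-- `F (e_{j+1} ⊗ u, 0) = (e_{j+1} ⊗ u, 0)` and `F (0, e_{j+1} ⊗ u) = (0, e_{j+1} ⊗ u)`: bath
displacements are fixed. [folklore] -/
theorem fl_single_succ (j : Fin n) (u : Space) :
    Fl (Pi.single j.succ u, 0) = (Pi.single j.succ u, 0) ∧
      Fl (0, Pi.single j.succ u) = (0, Pi.single j.succ u) := by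
  rw [hFl, hFl]
  dsimp only
  rw [Pi.zero_apply, Pi.single_eq_of_ne (Fin.succ_ne_zero j).symm, tail_single_succ, tail_zero,
    Matrix.cons_zero_zero, vecCons_zero_single]
  exact ⟨rfl, rfl⟩

end Directions

/-! #### Sliced partial derivatives through the full derivative -/

section Slices

variable {E₁ E₂ G : Type*} [NormedAddCommGroup E₁] [NormedSpace ℝ E₁] [NormedAddCommGroup E₂]
  [NormedSpace ℝ E₂] [NormedAddCommGroup G] [NormedSpace ℝ G] {Θ : E₁ × E₂ → G}

/-- `∂_d [X ↦ Θ(X, Y)] = DΘ(X, Y)(d, 0)`. [folklore] -/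
theorem fderiv_slice_fst (hΘ : Differentiable ℝ Θ) (X : E₁) (Y : E₂) (d : E₁) :
    fderiv ℝ (fun X => Θ (X, Y)) X d = fderiv ℝ Θ (X, Y) (d, 0) := by
  have h : HasFDerivAt (fun X => Θ (X, Y))
      ((fderiv ℝ Θ (X, Y)).comp (ContinuousLinearMap.inl ℝ E₁ E₂)) X :=
    (hΘ (X, Y)).hasFDerivAt.comp X (hasFDerivAt_prodMk_left X Y)
  rw [h.fderiv, ContinuousLinearMap.coe_comp, Function.comp_apply, ContinuousLinearMap.inl_apply]

/-- `∂_d [Y ↦ Θ(X, Y)] = DΘ(X, Y)(0, d)`. [folklore] -/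
theorem fderiv_slice_snd (hΘ : Differentiable ℝ Θ) (X : E₁) (Y : E₂) (d : E₂) :
    fderiv ℝ (fun Y => Θ (X, Y)) Y d = fderiv ℝ Θ (X, Y) (0, d) := by
  have h : HasFDerivAt (fun Y => Θ (X, Y))
      ((fderiv ℝ Θ (X, Y)).comp (ContinuousLinearMap.inr ℝ E₁ E₂)) Y :=
    (hΘ (X, Y)).hasFDerivAt.comp Y (hasFDerivAt_prodMk_right X Y)
  rw [h.fderiv, ContinuousLinearMap.coe_comp, Function.comp_apply, ContinuousLinearMap.inr_apply]

/-- `∂_d [X ↦ Θ(A(X, Y))] = DΘ(A(X, Y))(A(d, 0))` for a continuous linear `A`. [folklore] -/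
theorem fderiv_slice_fst_comp (A : (E₁ × E₂) →L[ℝ] (E₁ × E₂)) (hΘ : Differentiable ℝ Θ)
    (X : E₁) (Y : E₂) (d : E₁) :
    fderiv ℝ (fun X => Θ (A (X, Y))) X d = fderiv ℝ Θ (A (X, Y)) (A (d, 0)) := by
  have h : HasFDerivAt (fun X => Θ (A (X, Y)))
      ((fderiv ℝ Θ (A (X, Y))).comp (A.comp (ContinuousLinearMap.inl ℝ E₁ E₂))) X :=
    (hΘ (A (X, Y))).hasFDerivAt.comp X (A.hasFDerivAt.comp X (hasFDerivAt_prodMk_left X Y))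
  rw [h.fderiv, ContinuousLinearMap.coe_comp, Function.comp_apply, ContinuousLinearMap.coe_comp,
    Function.comp_apply, ContinuousLinearMap.inl_apply]

/-- `∂_d [Y ↦ Θ(A(X, Y))] = DΘ(A(X, Y))(A(0, d))` for a continuous linear `A`. [folklore] -/
theorem fderiv_slice_snd_comp (A : (E₁ × E₂) →L[ℝ] (E₁ × E₂)) (hΘ : Differentiable ℝ Θ)
    (X : E₁) (Y : E₂) (d : E₂) :
    fderiv ℝ (fun Y => Θ (A (X, Y))) Y d = fderiv ℝ Θ (A (X, Y)) (A (0, d)) := by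
  have h : HasFDerivAt (fun Y => Θ (A (X, Y)))
      ((fderiv ℝ Θ (A (X, Y))).comp (A.comp (ContinuousLinearMap.inr ℝ E₁ E₂))) Y :=
    (hΘ (A (X, Y))).hasFDerivAt.comp Y (A.hasFDerivAt.comp Y (hasFDerivAt_prodMk_right X Y))
  rw [h.fderiv, ContinuousLinearMap.coe_comp, Function.comp_apply, ContinuousLinearMap.coe_comp,
    Function.comp_apply, ContinuousLinearMap.inr_apply]

end Slices

/-! #### `Θ ∘ F`: kinetic density, smoothness, periodicity -/

/-- **Chain rule for the swap.** With `Φ = Θ ∘ F`, the two-copy kinetic density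
`|∇_X Φ|²(Z) + |∇_Y Φ|²(Z)` equals `|∇_X Θ|²(F Z) + |∇_Y Θ|²(F Z)`: `F` permutes the
coordinate directions (the tagged directions of the two copies trade places, the bath
directions stay). [folklore] -/
theorem kinetic_comp (Fl : (Config (n + 1) × Config (n + 1)) →L[ℝ] (Config (n + 1) × Config (n + 1)))
    (hFl : ∀ Z, Fl Z = (Matrix.vecCons (Z.2 0) (Fin.tail Z.1), Matrix.vecCons (Z.1 0) (Fin.tail Z.2)))
    {Θ Φ : Config (n + 1) × Config (n + 1) → ℂ} (hΦ : ∀ W, Φ W = Θ (Fl W)) (hΘ : Differentiable ℝ Θ)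
    (Z : Config (n + 1) × Config (n + 1)) :
    kineticDensity (fun X => Φ (X, Z.2)) Z.1 + kineticDensity (fun Y => Φ (Z.1, Y)) Z.2 =
      kineticDensity (fun X => Θ (X, (Fl Z).2)) (Fl Z).1 +
        kineticDensity (fun Y => Θ ((Fl Z).1, Y)) (Fl Z).2 := by
  obtain rfl : Φ = fun W => Θ (Fl W) := funext hΦ
  simp only [kineticDensity, fderiv_slice_fst_comp Fl hΘ, fderiv_slice_snd_comp Fl hΘ,
    fderiv_slice_fst hΘ, fderiv_slice_snd hΘ, Prod.mk.eta]
  simp only [Fin.sum_univ_succ (n := n), (fl_single_zero Fl hFl _).1, (fl_single_zero Fl hFl _).2,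
    (fl_single_succ Fl hFl _ _).1, (fl_single_succ Fl hFl _ _).2]
  abel

/-- `Θ ∘ F` is `C¹` if `Θ` is. [folklore] -/
theorem contDiff_comp_swap {Θ Φ : Config (n + 1) × Config (n + 1) → ℂ} (hΘ : ContDiff ℝ 1 Θ)
    (hΦ : ∀ W, Φ W = Θ (Matrix.vecCons (W.2 0) (Fin.tail W.1), Matrix.vecCons (W.1 0) (Fin.tail W.2))) :
    ContDiff ℝ 1 Φ := by
  obtain ⟨Fl, hFl⟩ := exists_clm n
  obtain rfl : Φ = Θ ∘ Fl := funext fun W => by rw [hΦ, Function.comp_apply, hFl]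
  exact hΘ.comp Fl.contDiff

/-- `Θ ∘ F` is `Lℤ³`-periodic in every particle of both copies if `Θ` is: `F` maps each
generator `(e_{i,k} L, 0)` / `(0, e_{i,k} L)` of the period lattice to another generator. [folklore] -/
theorem periodic_comp {L : ℝ} {Θ Φ : Config (n + 1) × Config (n + 1) → ℂ}
    (hper : ∀ (Z : Config (n + 1) × Config (n + 1)) (i : Fin (n + 1)) (k : Fin 3),
      Θ (Z.1 + Pi.single i (EuclideanSpace.single k L), Z.2) = Θ Z ∧
        Θ (Z.1, Z.2 + Pi.single i (EuclideanSpace.single k L)) = Θ Z)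
    (hΦ : ∀ W, Φ W = Θ (Matrix.vecCons (W.2 0) (Fin.tail W.1), Matrix.vecCons (W.1 0) (Fin.tail W.2)))
    (Z : Config (n + 1) × Config (n + 1)) (i : Fin (n + 1)) (k : Fin 3) :
    Φ (Z.1 + Pi.single i (EuclideanSpace.single k L), Z.2) = Φ Z ∧
      Φ (Z.1, Z.2 + Pi.single i (EuclideanSpace.single k L)) = Φ Z := by
  obtain ⟨Fl, hFl⟩ := exists_clm n
  obtain rfl : Φ = fun W => Θ (Fl W) := funext fun W => by rw [hΦ, hFl]
  set u : Space := EuclideanSpace.single k L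
  have e1 : (Z.1 + Pi.single i u, Z.2) = Z + (Pi.single i u, 0) := Prod.ext (by simp) (by simp)
  have e2 : (Z.1, Z.2 + Pi.single i u) = Z + (0, Pi.single i u) := Prod.ext (by simp) (by simp)
  have e3 : ∀ s : Config (n + 1), Fl Z + (s, 0) = ((Fl Z).1 + s, (Fl Z).2) := fun s =>
    Prod.ext (by simp) (by simp)
  have e4 : ∀ s : Config (n + 1), Fl Z + (0, s) = ((Fl Z).1, (Fl Z).2 + s) := fun s =>
    Prod.ext (by simp) (by simp)
  dsimp only
  rw [e1, e2, map_add, map_add]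
  rcases Fin.eq_zero_or_eq_succ i with rfl | ⟨j, rfl⟩
  · rw [(fl_single_zero Fl hFl u).1, (fl_single_zero Fl hFl u).2, e3, e4]
    exact ⟨(hper (Fl Z) 0 k).2, (hper (Fl Z) 0 k).1⟩
  · rw [(fl_single_succ Fl hFl j u).1, (fl_single_succ Fl hFl j u).2, e3, e4]
    exact ⟨(hper (Fl Z) j.succ k).1, (hper (Fl Z) j.succ k).2⟩

/-! #### Change of variables under the swap -/

/-- **Change of variables under the swap.** The one-pair swap is a measure-preserving measurable
involution of `(ℝ³)^{n+1} × (ℝ³)^{n+1}` (in glue coordinates it is `Prod.map id Prod.swap`)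
mapping `cell × cell` onto itself, so `∫_{cell²} g ∘ F = ∫_{cell²} g` for every `g ≥ 0`.
[folklore] -/
theorem setLIntegral_comp_swap (n : ℕ) (L : ℝ) (g : Config (n + 1) × Config (n + 1) → ℝ≥0∞) :
    ∫⁻ Z in cellN (n + 1) L ×ˢ cellN (n + 1) L,
        g (Matrix.vecCons (Z.2 0) (Fin.tail Z.1), Matrix.vecCons (Z.1 0) (Fin.tail Z.2)) =
      ∫⁻ Z in cellN (n + 1) L ×ˢ cellN (n + 1) L, g Z := by
  obtain ⟨e, he, hecoe⟩ := exists_measurableEquiv_twoCopy n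
  set Fme : Config (n + 1) × Config (n + 1) ≃ᵐ Config (n + 1) × Config (n + 1) :=
    e.symm.trans (((MeasurableEquiv.refl (Config n × Config n)).prodCongr
      (MeasurableEquiv.prodComm (α := Space) (β := Space))).trans e) with hFme_def
  have hFme : ∀ Z, Fme Z =
      (Matrix.vecCons (Z.2 0) (Fin.tail Z.1), Matrix.vecCons (Z.1 0) (Fin.tail Z.2)) := by
    intro Z
    have hZ := e.apply_symm_apply Z
    rw [hecoe] at hZ
    have h1 : Z.1 = Matrix.vecCons (e.symm Z).2.1 (e.symm Z).1.1 := (congrArg Prod.fst hZ).symm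
    have h2 : Z.2 = Matrix.vecCons (e.symm Z).2.2 (e.symm Z).1.2 := (congrArg Prod.snd hZ).symm
    rw [h1, h2]
    simp only [hFme_def, MeasurableEquiv.coe_trans, Function.comp_apply, hecoe, Matrix.cons_val_zero,
      tail_vecCons]
    rfl
  have hmid : MeasurePreserving
      ((MeasurableEquiv.refl (Config n × Config n)).prodCongr
        (MeasurableEquiv.prodComm (α := Space) (β := Space))) volume volume :=
    (MeasurePreserving.id (volume : Measure (Config n × Config n))).prod
      (Measure.measurePreserving_swap (μ := (volume : Measure Space))
        (ν := (volume : Measure Space)))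
  have hF : MeasurePreserving Fme volume volume := he.symm.trans (hmid.trans he)
  have hpre : Fme ⁻¹' (cellN (n + 1) L ×ˢ cellN (n + 1) L) = cellN (n + 1) L ×ˢ cellN (n + 1) L := by
    ext Z
    simp only [Set.mem_preimage, hFme, Set.mem_prod, cellN, Set.mem_setOf_eq, Fin.forall_fin_succ,
      Matrix.cons_val_zero, Matrix.cons_val_succ, tail_apply]
    tauto
  have key := hF.setLIntegral_comp_preimage_emb Fme.measurableEmbedding g
    (cellN (n + 1) L ×ˢ cellN (n + 1) L)
  rw [hpre] at key
  simp only [hFme] at key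
  exact key

/-! #### The integrand identity -/

/-- **The `E2(½)` integrand of `Φ = Θ ∘ F` at `Z` is that of `Θ` at `F Z`**: the kinetic part by
`kinetic_comp`, the weight `W` by `W (F Z) = W Z` (tails unchanged, the four tagged–bath cross
terms permuted), the density by `Φ Z = Θ (F Z)`. [folklore] -/
theorem integrand_swap (v : ℝ → ℝ≥0∞) (L : ℝ) {Θ Φ : Config (n + 1) × Config (n + 1) → ℂ}
    (hΘ : Differentiable ℝ Θ)
    (hΦ : ∀ W, Φ W = Θ (Matrix.vecCons (W.2 0) (Fin.tail W.1), Matrix.vecCons (W.1 0) (Fin.tail W.2)))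
    (Z : Config (n + 1) × Config (n + 1)) :
    kineticDensity (fun X => Φ (X, Z.2)) Z.1 + kineticDensity (fun Y => Φ (Z.1, Y)) Z.2 +
      (periodicInteraction v L (Fin.tail Z.1) + periodicInteraction v L (Fin.tail Z.2) +
        ∑ j : Fin n, (2 : ENNReal)⁻¹ * (periodizedPotential v L (Z.1 0 - Z.1 j.succ) +
          periodizedPotential v L (Z.2 0 - Z.2 j.succ) + periodizedPotential v L (Z.2 0 - Z.1 j.succ) +
          periodizedPotential v L (Z.1 0 - Z.2 j.succ))) * (‖Φ Z‖₊ : ENNReal) ^ 2 =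
    (fun Z : Config (n + 1) × Config (n + 1) =>
      kineticDensity (fun X => Θ (X, Z.2)) Z.1 + kineticDensity (fun Y => Θ (Z.1, Y)) Z.2 +
        (periodicInteraction v L (Fin.tail Z.1) + periodicInteraction v L (Fin.tail Z.2) +
          ∑ j : Fin n, (2 : ENNReal)⁻¹ * (periodizedPotential v L (Z.1 0 - Z.1 j.succ) +
            periodizedPotential v L (Z.2 0 - Z.2 j.succ) + periodizedPotential v L (Z.2 0 - Z.1 j.succ) +
            periodizedPotential v L (Z.1 0 - Z.2 j.succ))) * (‖Θ Z‖₊ : ENNReal) ^ 2)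
      (Matrix.vecCons (Z.2 0) (Fin.tail Z.1), Matrix.vecCons (Z.1 0) (Fin.tail Z.2)) := by
  obtain ⟨Fl, hFl⟩ := exists_clm n
  have hΦ' : ∀ W, Φ W = Θ (Fl W) := fun W => by rw [hΦ, hFl]
  rw [kinetic_comp Fl hFl hΦ' hΘ Z, hFl Z, hΦ Z]
  dsimp only
  simp only [Matrix.cons_val_zero, Matrix.cons_val_succ, tail_vecCons, tail_apply, mul_add,
    Finset.sum_add_distrib]
  ring

end SwapInvariance

/-! ### The registered stub -/

/-- **The one-pair swap preserves `Adm0` and `E2(½)`** (`stub_swapInvariance`, registered signature). [folklore] -/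
theorem stub_swapInvariance :
    ∀ v : ℝ → ℝ≥0∞, IsRepulsiveFiniteRange v → ∀ (n : ℕ) (L : ℝ) (Θ : Config (n + 1) × Config (n + 1) → ℂ),
      let C2 : Set (Config (n + 1) × Config (n + 1)) := (cellN (n + 1) L) ×ˢ (cellN (n + 1) L)
      let E2h : (Config (n + 1) × Config (n + 1) → ℂ) → ℝ≥0∞ := fun Θ => ∫⁻ Z in C2,
          (kineticDensity (fun X => Θ (X, Z.2)) Z.1 + kineticDensity (fun Y => Θ (Z.1, Y)) Z.2 +
            (periodicInteraction v L (Fin.tail Z.1) + periodicInteraction v L (Fin.tail Z.2) +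
              ∑ j : Fin n, (2 : ENNReal)⁻¹ * (periodizedPotential v L (Z.1 0 - Z.1 j.succ) +
                periodizedPotential v L (Z.2 0 - Z.2 j.succ) + periodizedPotential v L (Z.2 0 - Z.1 j.succ) +
                periodizedPotential v L (Z.1 0 - Z.2 j.succ))) * (‖Θ Z‖₊ : ENNReal) ^ 2)
      let Adm : (Config (n + 1) × Config (n + 1) → ℂ) → Prop := fun Θ => ContDiff ℝ 1 Θ ∧
          (∀ (Z : Config (n + 1) × Config (n + 1)) (i : Fin (n + 1)) (k : Fin 3),
            Θ (Z.1 + Pi.single i (EuclideanSpace.single k L), Z.2) = Θ Z ∧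
              Θ (Z.1, Z.2 + Pi.single i (EuclideanSpace.single k L)) = Θ Z) ∧
          ∫⁻ Z in C2, (‖Θ Z‖₊ : ENNReal) ^ 2 = 1
      let ΘF : Config (n + 1) × Config (n + 1) → ℂ := fun Z =>
        Θ (Matrix.vecCons (Z.2 0) (Fin.tail Z.1), Matrix.vecCons (Z.1 0) (Fin.tail Z.2))
      Adm Θ → Adm ΘF ∧ E2h ΘF = E2h Θ := by
  intro v _hv n L Θ
  dsimp only
  intro hΘ
  obtain ⟨hC1, hper, hnorm⟩ := hΘ
  refine ⟨⟨SwapInvariance.contDiff_comp_swap hC1 fun W => rfl,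
    fun Z i k => SwapInvariance.periodic_comp hper (fun W => rfl) Z i k, ?_⟩, ?_⟩
  · exact (SwapInvariance.setLIntegral_comp_swap n L (fun Z => (‖Θ Z‖₊ : ENNReal) ^ 2)).trans hnorm
  · refine Eq.trans ?_ (SwapInvariance.setLIntegral_comp_swap n L _)
    exact lintegral_congr fun Z =>
      SwapInvariance.integrand_swap v L (hC1.differentiable one_ne_zero) (fun W => rfl) Z

end Summit.AtomisticToContinuum.BoseEinsteinCondensation.Cruxes.TorusHalfSwapOverlap.Birth

end
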